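import Summits.NavierStokesRegularity.FunctionalMining.TopEigDanskin
import HarnessLib

/-!
# FunctionalMining — eigenpair calculus along a line: Hellmann–Feynman, the channel identity and the
# density identity (F1 PART I, Proposition 3, one-parameter form)

Search for candidate a priori estimates; no regularity claim. Cell `pub-nsfunc`, prove seat
(gen 22). Kernel form of the differentiation step of the no-go seat's F1 PART I PROPOSITION 3
("density identity"; pen, countersigned in the cell — not a cited fact), in the one-parameter form
from which the torus statement is assembled direction by direction (`TopEigDensityIdentity.lean`).
For a family of real symmetric matrices `t ↦ A(t)` and an eigenpair `A(t) e(t) = μ(t) e(t)` with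
`|e(t)| = 1` near `t₀`, differentiable at `t₀` (entrywise hypotheses, so that no norm on matrices is
chosen):

* `TopEig.hasDerivAt_eigenvalue_line` (HELLMANN–FEYNMAN): `μ'(t₀) = e(t₀)ᵀ A'(t₀) e(t₀)`;
* `TopEig.eigenEquation_deriv`: `A' e + A e' = μ' e + μ e'`;
* `TopEig.eigenpair_channel_eq` (the CHANNEL IDENTITY): `e'ᵀ A' e = μ |e'|² − e'ᵀ A e'`, hence
  **`TopEig.eigenpair_channel_nonneg_of_top`**: if `e(t₀)` is a TOP vector of `A(t₀)` then
  `e'ᵀ A' e = e'ᵀ (μ − A) e' ≥ 0` — the "rotation/tilt channels" of the density are non-negative with no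
  inverse `(λ₁ − S)⁻¹` and no simplicity hypothesis in the statement;
* `TopEig.hasDerivAt_deriv_eigenvalue_line`: `μ''(t₀) = eᵀ A'' e + 2 e'ᵀ A' e`;
* **`TopEig.hasDerivAt_deriv_eigenvalue_rpow_line`** / `TopEig.densityIdentity_line` (PROPOSITION 3,
  identity (2), along a line): for `μ(t₀) > 0` and real `q`,
  `−q μ^{q−1} eᵀA''e = [q(q−1) μ^{q−2} (eᵀA'e)² + 2q μ^{q−1} (μ|e'|² − e'ᵀAe')] − (μ^q)''(t₀)`:
  the density seen by the selection `e` is the non-negative channel sum minus an exact second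
  derivative.

Applied in `TopEigDensityIdentity.lean` with `A(t) = S(v)(x + t e_k)`: summing over `k` turns second
derivatives into the torus Laplacian, whose integral vanishes. Elementary one-variable calculus
(`HasDerivAt` product rules, uniqueness of derivatives, `Real.rpow`). [ours; folklore — first-order
perturbation theory of a simple eigenvalue (Hellmann–Feynman), written for a given differentiable
eigenpair so that no existence theorem is needed.]
-/

noncomputable section

open Filter Topology Set Matrix

namespace Summit.NavierStokesRegularity.FunctionalMining

namespace TopEig

variable {d : Type*} [Fintype d]

/-! ## 1. Product rule for `t ↦ u(t)ᵀ A(t) w(t)` (entrywise hypotheses) -/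

/-- Expansion `uᵀ M b = ∑ᵢ ∑ⱼ uᵢ Mᵢⱼ bⱼ`. [folklore] -/
theorem dotProduct_mulVec_eq_sum_sum (a : d → ℝ) (M : Matrix d d ℝ) (b : d → ℝ) :
    a ⬝ᵥ (M *ᵥ b) = ∑ i, ∑ j, a i * M i j * b j := by
  simp only [dotProduct, Matrix.mulVec, Finset.mul_sum]
  exact Finset.sum_congr rfl fun i _ => Finset.sum_congr rfl fun j _ => by ring

/-- **Product rule** for `t ↦ u(t)ᵀ A(t) w(t)` with entrywise derivatives `u', A', w'` at `t₀`:
the derivative is `u'ᵀ A w + uᵀ A' w + uᵀ A w'`. [folklore] -/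
theorem hasDerivAt_dotProduct_mulVec_line {u w : ℝ → d → ℝ} {A : ℝ → Matrix d d ℝ}
    {u' w' : d → ℝ} {A' : Matrix d d ℝ} {t₀ : ℝ}
    (hu : ∀ i, HasDerivAt (fun t => u t i) (u' i) t₀)
    (hA : ∀ i j, HasDerivAt (fun t => A t i j) (A' i j) t₀)
    (hw : ∀ j, HasDerivAt (fun t => w t j) (w' j) t₀) :
    HasDerivAt (fun t => u t ⬝ᵥ (A t *ᵥ w t))
      (u' ⬝ᵥ (A t₀ *ᵥ w t₀) + u t₀ ⬝ᵥ (A' *ᵥ w t₀) + u t₀ ⬝ᵥ (A t₀ *ᵥ w')) t₀ := by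
  have hterm : ∀ i j, HasDerivAt (fun t => u t i * A t i j * w t j)
      (u' i * A t₀ i j * w t₀ j + u t₀ i * A' i j * w t₀ j + u t₀ i * A t₀ i j * w' j) t₀ := by
    intro i j
    refine (((hu i).mul (hA i j)).mul (hw j)).congr_deriv ?_
    simp only [Pi.mul_apply]
    ring
  have hsum : HasDerivAt (fun t => ∑ i, ∑ j, u t i * A t i j * w t j)
      (∑ i, ∑ j, (u' i * A t₀ i j * w t₀ j + u t₀ i * A' i j * w t₀ j +
        u t₀ i * A t₀ i j * w' j)) t₀ :=
    HasDerivAt.fun_sum fun i _ => HasDerivAt.fun_sum fun j _ => hterm i j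
  have hfun : (fun t => u t ⬝ᵥ (A t *ᵥ w t)) = fun t => ∑ i, ∑ j, u t i * A t i j * w t j :=
    funext fun t => dotProduct_mulVec_eq_sum_sum _ _ _
  rw [hfun]
  convert hsum using 1
  simp only [dotProduct_mulVec_eq_sum_sum, ← Finset.sum_add_distrib]

/-! ## 2. Unit vectors: `e' ⊥ e`; symmetric families have symmetric derivatives -/

/-- If `|e(t)| = 1` near `t₀` and `e` is differentiable at `t₀` (entrywise, derivative `e'`), then
`e' · e(t₀) = 0`. [folklore] -/
theorem dotProduct_deriv_eq_zero_of_unit {e : ℝ → d → ℝ} {e' : d → ℝ} {t₀ : ℝ}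
    (he : ∀ i, HasDerivAt (fun t => e t i) (e' i) t₀) (hunit : ∀ᶠ t in 𝓝 t₀, e t ⬝ᵥ e t = 1) :
    e' ⬝ᵥ e t₀ = 0 := by
  have h1 : HasDerivAt (fun t => e t ⬝ᵥ e t) (∑ i, (e' i * e t₀ i + e t₀ i * e' i)) t₀ := by
    have h := HasDerivAt.fun_sum (u := Finset.univ) fun i _ => (he i).mul (he i)
    simp only [dotProduct]
    exact h
  have h2 : HasDerivAt (fun t => e t ⬝ᵥ e t) 0 t₀ :=
    (hasDerivAt_const t₀ (1 : ℝ)).congr_of_eventuallyEq hunit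
  have h12 := h1.unique h2
  have hsum : ∑ i, (e' i * e t₀ i + e t₀ i * e' i) = 2 * (e' ⬝ᵥ e t₀) := by
    simp only [dotProduct, Finset.mul_sum]
    exact Finset.sum_congr rfl fun i _ => by ring
  rw [hsum] at h12
  linarith

omit [Fintype d] in
/-- A family of symmetric matrices that is entrywise differentiable at `t₀` has a symmetric
derivative there. [folklore] -/
theorem isSymm_of_hasDerivAt {A : ℝ → Matrix d d ℝ} {A' : Matrix d d ℝ} {t₀ : ℝ}
    (hA : ∀ i j, HasDerivAt (fun t => A t i j) (A' i j) t₀) (hsymm : ∀ᶠ t in 𝓝 t₀, (A t).IsSymm) :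
    A'.IsSymm := by
  ext i j
  have h : (fun t => A t j i) =ᶠ[𝓝 t₀] fun t => A t i j := by
    filter_upwards [hsymm] with t ht
    exact ht.apply i j
  exact (hA j i).unique ((hA i j).congr_of_eventuallyEq h)

/-- For a symmetric matrix, `aᵀ M b = bᵀ M a`. [folklore] -/
theorem dotProduct_mulVec_comm_of_isSymm {M : Matrix d d ℝ} (hM : M.IsSymm) (a b : d → ℝ) :
    a ⬝ᵥ (M *ᵥ b) = b ⬝ᵥ (M *ᵥ a) := by
  rw [dotProduct_mulVec, ← Matrix.mulVec_transpose, hM.eq, dotProduct_comm]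

/-! ## 3. Hellmann–Feynman: `μ' = eᵀ A' e` -/

/-- **HELLMANN–FEYNMAN along a line.** Let `A(t)` be real matrices with `A(t₀)` symmetric,
entrywise differentiable at `t₀` with derivative `A'`, and let `A(t) e(t) = μ(t) e(t)` with
`|e(t)| = 1` for `t` near `t₀`, `e` entrywise differentiable at `t₀`. Then `μ` is differentiable at
`t₀` with `μ'(t₀) = e(t₀)ᵀ A' e(t₀)`. (No simplicity of `μ` is assumed: the differentiable eigenpair is
given.) [folklore; F1 PART I Prop. 3, `∂ₖλ₁ = ⟨e₁, ∂ₖS e₁⟩`] -/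
theorem hasDerivAt_eigenvalue_line {A : ℝ → Matrix d d ℝ} {A' : Matrix d d ℝ} {e : ℝ → d → ℝ}
    {e' : d → ℝ} {μ : ℝ → ℝ} {t₀ : ℝ}
    (hA : ∀ i j, HasDerivAt (fun t => A t i j) (A' i j) t₀)
    (he : ∀ i, HasDerivAt (fun t => e t i) (e' i) t₀) (hsymm : (A t₀).IsSymm)
    (heig : ∀ᶠ t in 𝓝 t₀, A t *ᵥ e t = μ t • e t) (hunit : ∀ᶠ t in 𝓝 t₀, e t ⬝ᵥ e t = 1) :
    HasDerivAt μ (e t₀ ⬝ᵥ (A' *ᵥ e t₀)) t₀ := by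
  -- `μ` agrees with the Rayleigh quotient near `t₀`
  have hray : μ =ᶠ[𝓝 t₀] fun t => e t ⬝ᵥ (A t *ᵥ e t) := by
    filter_upwards [heig, hunit] with t h1 h2
    rw [h1, dotProduct_smul, h2, smul_eq_mul, mul_one]
  have hD := hasDerivAt_dotProduct_mulVec_line he hA he
  have h0 : e' ⬝ᵥ e t₀ = 0 := dotProduct_deriv_eq_zero_of_unit he hunit
  have heig0 : A t₀ *ᵥ e t₀ = μ t₀ • e t₀ := heig.self_of_nhds
  have hval : e' ⬝ᵥ (A t₀ *ᵥ e t₀) + e t₀ ⬝ᵥ (A' *ᵥ e t₀) + e t₀ ⬝ᵥ (A t₀ *ᵥ e') =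
      e t₀ ⬝ᵥ (A' *ᵥ e t₀) := by
    rw [dotProduct_mulVec_comm_of_isSymm hsymm (e t₀) e', heig0, dotProduct_smul, smul_eq_mul, h0,
      mul_zero, zero_add, add_zero]
  exact (hD.congr_deriv hval).congr_of_eventuallyEq hray

/-! ## 4. The differentiated eigen-equation and the channel identity -/

/-- **The differentiated eigen-equation**: `A' e + A e' = μ' e + μ e'` at `t₀`. [folklore;
F1 PART I Prop. 3, proof] -/
theorem eigenEquation_deriv {A : ℝ → Matrix d d ℝ} {A' : Matrix d d ℝ} {e : ℝ → d → ℝ}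
    {e' : d → ℝ} {μ : ℝ → ℝ} {μ' t₀ : ℝ}
    (hA : ∀ i j, HasDerivAt (fun t => A t i j) (A' i j) t₀)
    (he : ∀ i, HasDerivAt (fun t => e t i) (e' i) t₀) (hμ : HasDerivAt μ μ' t₀)
    (heig : ∀ᶠ t in 𝓝 t₀, A t *ᵥ e t = μ t • e t) :
    A' *ᵥ e t₀ + A t₀ *ᵥ e' = μ' • e t₀ + μ t₀ • e' := by
  ext i
  have h1 : HasDerivAt (fun t => (A t *ᵥ e t) i) (∑ j, (A' i j * e t₀ j + A t₀ i j * e' j)) t₀ := by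
    have h := HasDerivAt.fun_sum (u := Finset.univ) fun j _ => (hA i j).mul (he j)
    simp only [Matrix.mulVec, dotProduct]
    exact h
  have h2 : HasDerivAt (fun t => (μ t • e t) i) (μ' * e t₀ i + μ t₀ * e' i) t₀ := by
    simp only [Pi.smul_apply, smul_eq_mul]
    exact hμ.mul (he i)
  have h12 : (fun t => (μ t • e t) i) =ᶠ[𝓝 t₀] fun t => (A t *ᵥ e t) i := by
    filter_upwards [heig] with t ht
    rw [ht]
  have h := (h1.congr_of_eventuallyEq h12).unique h2
  simp only [Pi.add_apply, Pi.smul_apply, smul_eq_mul, Matrix.mulVec, dotProduct, ← Finset.sum_add_distrib]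
  rw [h]

/-- **THE CHANNEL IDENTITY.** With the hypotheses of `hasDerivAt_eigenvalue_line`:
`e'ᵀ A' e = μ |e'|² − e'ᵀ A e'` at `t₀` (pair the differentiated eigen-equation with `e' ⊥ e`).
[folklore; F1 PART I Prop. 3, `⟨∂ₖe₁, ∂ₖS e₁⟩ = ⟨R wₖ, wₖ⟩`, in inverse-free form] -/
theorem eigenpair_channel_eq {A : ℝ → Matrix d d ℝ} {A' : Matrix d d ℝ} {e : ℝ → d → ℝ}
    {e' : d → ℝ} {μ : ℝ → ℝ} {t₀ : ℝ}
    (hA : ∀ i j, HasDerivAt (fun t => A t i j) (A' i j) t₀)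
    (he : ∀ i, HasDerivAt (fun t => e t i) (e' i) t₀) (hsymm : (A t₀).IsSymm)
    (heig : ∀ᶠ t in 𝓝 t₀, A t *ᵥ e t = μ t • e t) (hunit : ∀ᶠ t in 𝓝 t₀, e t ⬝ᵥ e t = 1) :
    e' ⬝ᵥ (A' *ᵥ e t₀) = μ t₀ * (e' ⬝ᵥ e') - e' ⬝ᵥ (A t₀ *ᵥ e') := by
  have hμ := hasDerivAt_eigenvalue_line hA he hsymm heig hunit
  have h := eigenEquation_deriv hA he hμ heig
  have h0 : e' ⬝ᵥ e t₀ = 0 := dotProduct_deriv_eq_zero_of_unit he hunit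
  have h' := congrArg (fun v => e' ⬝ᵥ v) h
  simp only [dotProduct_add, dotProduct_smul, smul_eq_mul, h0, mul_zero, zero_add] at h'
  linarith

/-- **The channels are non-negative at a top vector.** With the hypotheses of
`hasDerivAt_eigenvalue_line`, if `e(t₀)` is a TOP vector of `A(t₀)` (`e(t₀) ∈ E(A(t₀))`, the top
eigen-set of `TopEigDanskin.lean`), then `e'ᵀ A' e(t₀) = e'ᵀ(λ₁ − A(t₀))e' ≥ 0`. This is the sign of
the "rotation" and "tilt" channels of the density `F_q` (F1 PART I (1)), obtained without the inverse
`(λ₁ − S)⁻¹` and without assuming `λ₁` simple. [ours; folklore] -/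
theorem eigenpair_channel_nonneg_of_top {A : ℝ → Matrix d d ℝ} {A' : Matrix d d ℝ}
    {e : ℝ → d → ℝ} {e' : d → ℝ} {μ : ℝ → ℝ} {t₀ : ℝ}
    (hA : ∀ i j, HasDerivAt (fun t => A t i j) (A' i j) t₀)
    (he : ∀ i, HasDerivAt (fun t => e t i) (e' i) t₀) (hsymm : (A t₀).IsSymm)
    (heig : ∀ᶠ t in 𝓝 t₀, A t *ᵥ e t = μ t • e t) (hunit : ∀ᶠ t in 𝓝 t₀, e t ⬝ᵥ e t = 1)
    (htop : e t₀ ∈ topEigSet (SharpClass.DirectorForm.flat (A t₀))) :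
    0 ≤ e' ⬝ᵥ (A' *ᵥ e t₀) := by
  rw [eigenpair_channel_eq hA he hsymm heig hunit]
  -- `μ(t₀) = λ₁(A(t₀))`: the Rayleigh value of the top vector `e(t₀)`
  have hμ : μ t₀ = lam (SharpClass.DirectorForm.flat (A t₀)) := by
    have h1 : quad (SharpClass.DirectorForm.flat (A t₀)) (e t₀) = μ t₀ := by
      rw [SharpClass.DirectorForm.quad_flat, heig.self_of_nhds, dotProduct_smul, hunit.self_of_nhds,
        smul_eq_mul, mul_one]
    rw [← h1, htop.2]
  have hle := quad_le_lam_mul (SharpClass.DirectorForm.flat (A t₀)) e'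
  rw [SharpClass.DirectorForm.quad_flat, ← hμ] at hle
  linarith

/-- The same at a BOTTOM vector: if `e(t₀)` is a top vector of `−A(t₀)` (a unit bottom eigenvector
of `A(t₀)`), then `e'ᵀ A' e(t₀) = e'ᵀ(λ_min − A(t₀))e' ≤ 0` (the `−λ₃` core of the cell's
bookkeeping). [ours; folklore] -/
theorem eigenpair_channel_nonpos_of_bot {A : ℝ → Matrix d d ℝ} {A' : Matrix d d ℝ}
    {e : ℝ → d → ℝ} {e' : d → ℝ} {μ : ℝ → ℝ} {t₀ : ℝ}
    (hA : ∀ i j, HasDerivAt (fun t => A t i j) (A' i j) t₀)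
    (he : ∀ i, HasDerivAt (fun t => e t i) (e' i) t₀) (hsymm : (A t₀).IsSymm)
    (heig : ∀ᶠ t in 𝓝 t₀, A t *ᵥ e t = μ t • e t) (hunit : ∀ᶠ t in 𝓝 t₀, e t ⬝ᵥ e t = 1)
    (hbot : e t₀ ∈ topEigSet (SharpClass.DirectorForm.flat (-A t₀))) :
    e' ⬝ᵥ (A' *ᵥ e t₀) ≤ 0 := by
  rw [eigenpair_channel_eq hA he hsymm heig hunit]
  have hμ : -μ t₀ = lam (SharpClass.DirectorForm.flat (-A t₀)) := by
    have h1 : quad (SharpClass.DirectorForm.flat (-A t₀)) (e t₀) = -μ t₀ := by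
      rw [SharpClass.DirectorForm.quad_flat, Matrix.neg_mulVec, dotProduct_neg, heig.self_of_nhds,
        dotProduct_smul, hunit.self_of_nhds, smul_eq_mul, mul_one]
    rw [← h1, hbot.2]
  have hle := quad_le_lam_mul (SharpClass.DirectorForm.flat (-A t₀)) e'
  rw [SharpClass.DirectorForm.quad_flat, ← hμ, Matrix.neg_mulVec, dotProduct_neg] at hle
  linarith

/-! ## 5. The second derivative of the eigenvalue -/

/-- **Second derivative of the eigenvalue along a line.** Let `A(t)` be symmetric for `t` near `t₀`,
entrywise differentiable near `t₀` with derivative `A'(t)`, `A'` entrywise differentiable at `t₀`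
with derivative `A''`; let `A(t)e(t) = μ(t)e(t)`, `|e(t)| = 1` near `t₀` with `e` entrywise
differentiable near `t₀` and derivative `e'` at `t₀`. Then near `t₀`, `μ' = eᵀA'e`
(Hellmann–Feynman at every nearby time), and this function has derivative
`eᵀ A'' e + 2 e'ᵀ A' e` at `t₀`; so `μ''(t₀) = eᵀA''e + 2e'ᵀA'e`. [folklore; F1 PART I Prop. 3] -/
theorem hasDerivAt_deriv_eigenvalue_line {A A' : ℝ → Matrix d d ℝ} {A'' : Matrix d d ℝ}
    {e : ℝ → d → ℝ} {e' : d → ℝ} {μ : ℝ → ℝ} {t₀ : ℝ}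
    (hA : ∀ᶠ t in 𝓝 t₀, ∀ i j, HasDerivAt (fun s => A s i j) (A' t i j) t)
    (hA' : ∀ i j, HasDerivAt (fun t => A' t i j) (A'' i j) t₀)
    (he : ∀ᶠ t in 𝓝 t₀, ∀ i, DifferentiableAt ℝ (fun s => e s i) t)
    (he₀ : ∀ i, HasDerivAt (fun t => e t i) (e' i) t₀)
    (hsymm : ∀ᶠ t in 𝓝 t₀, (A t).IsSymm)
    (heig : ∀ᶠ t in 𝓝 t₀, A t *ᵥ e t = μ t • e t) (hunit : ∀ᶠ t in 𝓝 t₀, e t ⬝ᵥ e t = 1) :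
    (∀ᶠ t in 𝓝 t₀, HasDerivAt μ (e t ⬝ᵥ (A' t *ᵥ e t)) t) ∧
      HasDerivAt (fun t => e t ⬝ᵥ (A' t *ᵥ e t))
        (e t₀ ⬝ᵥ (A'' *ᵥ e t₀) + 2 * (e' ⬝ᵥ (A' t₀ *ᵥ e t₀))) t₀ ∧
      HasDerivAt (deriv μ) (e t₀ ⬝ᵥ (A'' *ᵥ e t₀) + 2 * (e' ⬝ᵥ (A' t₀ *ᵥ e t₀))) t₀ := by
  -- Hellmann–Feynman at every time near `t₀`
  have hHF : ∀ᶠ t in 𝓝 t₀, HasDerivAt μ (e t ⬝ᵥ (A' t *ᵥ e t)) t := by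
    filter_upwards [hA, he, hsymm, heig.eventually_nhds, hunit.eventually_nhds] with t h1 h2 h3 h4 h5
    exact hasDerivAt_eigenvalue_line h1 (fun i => (h2 i).hasDerivAt) h3 h4 h5
  -- the derivative of `t ↦ eᵀ A' e` at `t₀`
  have hsymm' : (A' t₀).IsSymm := isSymm_of_hasDerivAt hA.self_of_nhds hsymm
  have hD := hasDerivAt_dotProduct_mulVec_line he₀ hA' he₀
  have hval : e' ⬝ᵥ (A' t₀ *ᵥ e t₀) + e t₀ ⬝ᵥ (A'' *ᵥ e t₀) + e t₀ ⬝ᵥ (A' t₀ *ᵥ e') =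
      e t₀ ⬝ᵥ (A'' *ᵥ e t₀) + 2 * (e' ⬝ᵥ (A' t₀ *ᵥ e t₀)) := by
    rw [dotProduct_mulVec_comm_of_isSymm hsymm' (e t₀) e']
    ring
  have hD' := hD.congr_deriv hval
  refine ⟨hHF, hD', hD'.congr_of_eventuallyEq ?_⟩
  filter_upwards [hHF] with t ht
  exact ht.deriv

/-! ## 6. The density identity along a line (Proposition 3, identity (2)) -/

/-- **PROPOSITION 3 along a line (second derivative of `μ^q`).** Under the hypotheses of
`hasDerivAt_deriv_eigenvalue_line` and `μ(t₀) > 0`, for every real `q` the function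
`t ↦ (μ(t)^q)'` has derivative
`q(q−1) μ^{q−2} (eᵀA'e)² + q μ^{q−1} (eᵀA''e + 2(μ|e'|² − e'ᵀAe'))` at `t₀`
(chain rule, Hellmann–Feynman, the second-derivative formula and the channel identity).
[ours; F1 PART I Prop. 3 (2)] -/
theorem hasDerivAt_deriv_eigenvalue_rpow_line {A A' : ℝ → Matrix d d ℝ} {A'' : Matrix d d ℝ}
    {e : ℝ → d → ℝ} {e' : d → ℝ} {μ : ℝ → ℝ} {t₀ : ℝ} (q : ℝ)
    (hA : ∀ᶠ t in 𝓝 t₀, ∀ i j, HasDerivAt (fun s => A s i j) (A' t i j) t)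
    (hA' : ∀ i j, HasDerivAt (fun t => A' t i j) (A'' i j) t₀)
    (he : ∀ᶠ t in 𝓝 t₀, ∀ i, DifferentiableAt ℝ (fun s => e s i) t)
    (he₀ : ∀ i, HasDerivAt (fun t => e t i) (e' i) t₀)
    (hsymm : ∀ᶠ t in 𝓝 t₀, (A t).IsSymm)
    (heig : ∀ᶠ t in 𝓝 t₀, A t *ᵥ e t = μ t • e t) (hunit : ∀ᶠ t in 𝓝 t₀, e t ⬝ᵥ e t = 1)
    (hpos : 0 < μ t₀) :
    HasDerivAt (deriv fun t => μ t ^ q)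
      (q * (q - 1) * μ t₀ ^ (q - 2) * (e t₀ ⬝ᵥ (A' t₀ *ᵥ e t₀)) ^ 2 +
        q * μ t₀ ^ (q - 1) * (e t₀ ⬝ᵥ (A'' *ᵥ e t₀) +
          2 * (μ t₀ * (e' ⬝ᵥ e') - e' ⬝ᵥ (A t₀ *ᵥ e')))) t₀ := by
  obtain ⟨hHF, hD, -⟩ := hasDerivAt_deriv_eigenvalue_line hA hA' he he₀ hsymm heig hunit
  -- positivity near `t₀`
  have hμ₀ : HasDerivAt μ (e t₀ ⬝ᵥ (A' t₀ *ᵥ e t₀)) t₀ := hHF.self_of_nhds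
  have hpos' : ∀ᶠ t in 𝓝 t₀, 0 < μ t :=
    hμ₀.continuousAt.eventually (Ioi_mem_nhds hpos)
  -- the first derivative of `μ^q` near `t₀`
  have h1 : ∀ᶠ t in 𝓝 t₀, HasDerivAt (fun s => μ s ^ q)
      ((e t ⬝ᵥ (A' t *ᵥ e t)) * q * μ t ^ (q - 1)) t := by
    filter_upwards [hHF, hpos'] with t ht hp
    exact ht.rpow_const (Or.inl hp.ne')
  have hderiv : deriv (fun s => μ s ^ q) =ᶠ[𝓝 t₀]
      fun t => (e t ⬝ᵥ (A' t *ᵥ e t)) * q * μ t ^ (q - 1) := by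
    filter_upwards [h1] with t ht
    exact ht.deriv
  -- differentiate the product at `t₀`
  have hpow : HasDerivAt (fun t => μ t ^ (q - 1))
      ((e t₀ ⬝ᵥ (A' t₀ *ᵥ e t₀)) * (q - 1) * μ t₀ ^ (q - 1 - 1)) t₀ :=
    hμ₀.rpow_const (Or.inl hpos.ne')
  have hprod := (hD.mul_const q).mul hpow
  have hchan := eigenpair_channel_eq hA.self_of_nhds he₀ hsymm.self_of_nhds heig hunit
  refine (hprod.congr_of_eventuallyEq hderiv).congr_deriv ?_
  rw [hchan, show q - 1 - 1 = q - 2 by ring]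
  ring

/-- **THE DENSITY IDENTITY along a line (F1 PART I, Proposition 3, (2)).** Under the hypotheses of
`hasDerivAt_deriv_eigenvalue_rpow_line`: the "density seen by `e`" along the line,
`−q μ^{q−1} eᵀ A'' e`, equals the channel sum
`q(q−1) μ^{q−2} (eᵀA'e)² + 2q μ^{q−1} (μ|e'|² − e'ᵀAe')` (each channel `≥ 0` at a top vector when
`q ≥ 1`, `eigenpair_channel_nonneg_of_top`) minus the exact second derivative `(μ^q)''(t₀)`.
[ours; F1 PART I Prop. 3] -/
theorem densityIdentity_line {A A' : ℝ → Matrix d d ℝ} {A'' : Matrix d d ℝ}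
    {e : ℝ → d → ℝ} {e' : d → ℝ} {μ : ℝ → ℝ} {t₀ : ℝ} (q : ℝ)
    (hA : ∀ᶠ t in 𝓝 t₀, ∀ i j, HasDerivAt (fun s => A s i j) (A' t i j) t)
    (hA' : ∀ i j, HasDerivAt (fun t => A' t i j) (A'' i j) t₀)
    (he : ∀ᶠ t in 𝓝 t₀, ∀ i, DifferentiableAt ℝ (fun s => e s i) t)
    (he₀ : ∀ i, HasDerivAt (fun t => e t i) (e' i) t₀)
    (hsymm : ∀ᶠ t in 𝓝 t₀, (A t).IsSymm)
    (heig : ∀ᶠ t in 𝓝 t₀, A t *ᵥ e t = μ t • e t) (hunit : ∀ᶠ t in 𝓝 t₀, e t ⬝ᵥ e t = 1)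
    (hpos : 0 < μ t₀) :
    -(q * μ t₀ ^ (q - 1) * (e t₀ ⬝ᵥ (A'' *ᵥ e t₀))) =
      (q * (q - 1) * μ t₀ ^ (q - 2) * (e t₀ ⬝ᵥ (A' t₀ *ᵥ e t₀)) ^ 2 +
          2 * q * μ t₀ ^ (q - 1) * (μ t₀ * (e' ⬝ᵥ e') - e' ⬝ᵥ (A t₀ *ᵥ e'))) -
        deriv (deriv fun t => μ t ^ q) t₀ := by
  rw [(hasDerivAt_deriv_eigenvalue_rpow_line q hA hA' he he₀ hsymm heig hunit hpos).deriv]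
  ring

end TopEig

end Summit.NavierStokesRegularity.FunctionalMining

end
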